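import Literature.Probability.Percolation.SahiSunflowerSeparation
import Mathlib.Tactic.Linarith
import Mathlib.Tactic.Ring
import Mathlib.Tactic.Positivity
import HarnessLib

/-!
# Sahi's cubic on the pairwise intersections of three events — the `G`-form of the sunflower row

Support file for the master-family programme of crux `NoHeavyLowerTail` (stmt-CriticalPhenomena-4575),
lane P1 (prover-prim-masterthm-p1, gen 6).  Everything here is PROVED (measure bookkeeping and
elementary algebra); no definition, no named fact, no sorry.

## Context

For three events `U₁, U₂, U₃` forming a SUNFLOWER (all pairwise intersections equal to `A`), the tree has
`Literature.Probability.LatticeModels.sahiE3_compl_sunflower_eq`: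
`E₃(U₁ᶜ,U₂ᶜ,U₃ᶜ) = (1 + a)(a·b − e₂(c)) − e₃(c)` (`a = μ A`, `c_i` the petal masses, `b` the outside mass), and
records that `E₃(U₁ᶜ,U₂ᶜ,U₃ᶜ) ≥ 0` for increasing `U_i` under a product measure is an instance of the open
conjecture [cite: Kahn2022, Conjecture 5 (arXiv p. 3)]; its percolation instances are the tower rows
`3PT-LB` (a theorem, `ThreePointLB.sahiE3_pairSep_nonneg`), the four-point perfect-matching triple, and the
cubic sub-rows of `4PT-LB` (`SwitchRelax.Tower4Sub3.sahiE3_nonneg`).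

## What is proved here (bookkeeping; not stated in the sources)

* `pairInter_inter_eq₁₂/₁₃/₂₃`, `pairInter_inter₃_eq` — for ARBITRARY events `G₁, G₂, G₃` the three
  pairwise intersections `E₁ = G₂ ∩ G₃`, `E₂ = G₁ ∩ G₃`, `E₃ = G₁ ∩ G₂` form a sunflower with core
  `G₁ ∩ G₂ ∩ G₃`; conversely (`sunflower_eq_pairInter`) every sunflower member `U₁` (with
  `U₁ ∩ U₂ = U₂ ∩ U₃`) equals `(U₁ ∪ U₃) ∩ (U₁ ∪ U₂)`, so sunflowers are exactly pairwise-intersection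
  triples (`G_i = U_j ∪ U_k`).  Hence "Sahi's `C₃` on complements of sunflowers" is the same statement as
  "Sahi's `C₃` on the complements of the pairwise intersections of three arbitrary events".
* `sahiE3_compl_pairInter_eq` — the closed form in the masses `m_{ij} = μ(G_i ∩ G_j)`,
  `m = μ(G₁ ∩ G₂ ∩ G₃)` alone (the singles `μ G_i` do not enter), for every probability measure:
  `E₃((G₂∩G₃)ᶜ, (G₁∩G₃)ᶜ, (G₁∩G₂)ᶜ) = m·(1 + m₁₂ + m₁₃ + m₂₃) − (m₁₂m₁₃ + m₁₂m₂₃ + m₁₃m₂₃) − m₁₂m₁₃m₂₃`;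
  equivalently (`sahiE3_compl_pairInter_eq_prod_form`)
  `E₃ = (1 + m)(1 + m₁₂ + m₁₃ + m₂₃) − (1 + m₁₂)(1 + m₁₃)(1 + m₂₃)`, so the conjectured inequality reads
  `(1+m₁₂)(1+m₁₃)(1+m₂₃) ≤ (1+m)(1+m₁₂+m₁₃+m₂₃)`.
* `sahiE3_compl_pairInter_eq_of_indep`, `sahiE3_compl_pairInter_nonneg_of_indep` — if the three events
  satisfy the product rule pairwise and for the triple, the value is
  `μG₁·μG₂·μG₃·(1−μG₁)(1−μG₂)(1−μG₃) ≥ 0`: an elementary proved case of the conjecture lying OUTSIDE the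
  conditional-correlation class of the printed proofs (on sunflower complements each pair is
  conditionally negatively correlated given the third, tree `measureReal_compl_sunflower_condCov_eq`).

Numerical status of the conjecture for increasing events under product measures (this lane, gen 6,
HOME memo FROM-prim-masterthm-p1-g6-ABSTRACT-TOWER.md): every tensor-Bernstein ("comb") coefficient of
the cubic is nonnegative for every triple of up-sets of `{0,1}⁴` (exhaustive, 804 440 triples), hence the
inequality holds for every product measure on at most four coordinates; no violation among sampled triples
on up to nine coordinates; the bulk extremiser is the percolation triangle.
-/

noncomputable section

namespace Summit.CriticalPhenomena.PercolationContinuityZ3.Theorems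

namespace SahiPairInter

open MeasureTheory Set Literature.Probability.LatticeModels

variable {Ω : Type*}

/-! ### Pairwise intersections form a sunflower, and every sunflower arises this way -/

/-- `(G₂ ∩ G₃) ∩ (G₁ ∩ G₃) = G₁ ∩ G₂ ∩ G₃`. [folklore] -/
theorem pairInter_inter_eq₁₂ (G₁ G₂ G₃ : Set Ω) : (G₂ ∩ G₃) ∩ (G₁ ∩ G₃) = G₁ ∩ G₂ ∩ G₃ := by
  ext ω; simp only [mem_inter_iff]; tauto

/-- `(G₂ ∩ G₃) ∩ (G₁ ∩ G₂) = G₁ ∩ G₂ ∩ G₃`. [folklore] -/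
theorem pairInter_inter_eq₁₃ (G₁ G₂ G₃ : Set Ω) : (G₂ ∩ G₃) ∩ (G₁ ∩ G₂) = G₁ ∩ G₂ ∩ G₃ := by
  ext ω; simp only [mem_inter_iff]; tauto

/-- `(G₁ ∩ G₃) ∩ (G₁ ∩ G₂) = G₁ ∩ G₂ ∩ G₃`. [folklore] -/
theorem pairInter_inter_eq₂₃ (G₁ G₂ G₃ : Set Ω) : (G₁ ∩ G₃) ∩ (G₁ ∩ G₂) = G₁ ∩ G₂ ∩ G₃ := by
  ext ω; simp only [mem_inter_iff]; tauto

/-- `(G₂ ∩ G₃) ∩ (G₁ ∩ G₃) ∩ (G₁ ∩ G₂) = G₁ ∩ G₂ ∩ G₃`. [folklore] -/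
theorem pairInter_inter₃_eq (G₁ G₂ G₃ : Set Ω) :
    (G₂ ∩ G₃) ∩ (G₁ ∩ G₃) ∩ (G₁ ∩ G₂) = G₁ ∩ G₂ ∩ G₃ := by
  ext ω; simp only [mem_inter_iff]; tauto

/-- **Every sunflower is a pairwise-intersection triple:** if `U₁ ∩ U₂ = U₂ ∩ U₃` (both equal to the
core) then `U₁ = (U₁ ∪ U₃) ∩ (U₁ ∪ U₂)`, i.e. `U₁ = G₂ ∩ G₃` with `G₂ := U₁ ∪ U₃`, `G₃ := U₁ ∪ U₂`
(and symmetrically for `U₂`, `U₃`). [folklore] -/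
theorem sunflower_eq_pairInter {U₁ U₂ U₃ : Set Ω} (h : U₁ ∩ U₂ = U₂ ∩ U₃) :
    U₁ = (U₁ ∪ U₃) ∩ (U₁ ∪ U₂) := by
  ext ω
  simp only [mem_inter_iff, mem_union]
  constructor
  · intro h1; exact ⟨Or.inl h1, Or.inl h1⟩
  · rintro ⟨h1 | h3, h1' | h2⟩
    · exact h1
    · exact h1
    · exact h1'
    · have h23 : ω ∈ U₂ ∩ U₃ := ⟨h2, h3⟩
      rw [← h] at h23
      exact h23.1

/-! ### The closed form in the pairwise and triple intersection masses -/

section Measure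

variable [MeasurableSpace Ω] (μ : Measure Ω) [IsProbabilityMeasure μ]

/-- **Sahi's cubic on the complements of the pairwise intersections of three events (closed form).**
For every probability measure and measurable `G₁, G₂, G₃`, with `m_{ij} = μ(G_i ∩ G_j)`,
`m = μ(G₁ ∩ G₂ ∩ G₃)`:
`E₃((G₂∩G₃)ᶜ,(G₁∩G₃)ᶜ,(G₁∩G₂)ᶜ) = m(1 + m₁₂ + m₁₃ + m₂₃) − (m₁₂m₁₃ + m₁₂m₂₃ + m₁₃m₂₃) − m₁₂m₁₃m₂₃`.
The single masses `μ G_i` do not enter.  (Measure bookkeeping via the complement rule `sahiE3_compl`;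
not stated in the sources.) [cite: LiebSahi2021, eq. (2.1) (arXiv p. 5)] -/
theorem sahiE3_compl_pairInter_eq {G₁ G₂ G₃ : Set Ω} (h₁ : MeasurableSet G₁) (h₂ : MeasurableSet G₂)
    (h₃ : MeasurableSet G₃) :
    sahiE3 μ (G₂ ∩ G₃)ᶜ (G₁ ∩ G₃)ᶜ (G₁ ∩ G₂)ᶜ =
      μ.real (G₁ ∩ G₂ ∩ G₃) * (1 + μ.real (G₁ ∩ G₂) + μ.real (G₁ ∩ G₃) + μ.real (G₂ ∩ G₃)) -
        (μ.real (G₁ ∩ G₂) * μ.real (G₁ ∩ G₃) + μ.real (G₁ ∩ G₂) * μ.real (G₂ ∩ G₃) +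
          μ.real (G₁ ∩ G₃) * μ.real (G₂ ∩ G₃)) -
        μ.real (G₁ ∩ G₂) * μ.real (G₁ ∩ G₃) * μ.real (G₂ ∩ G₃) := by
  rw [sahiE3_compl μ (h₂.inter h₃) (h₁.inter h₃) (h₁.inter h₂), sahiE3_def, pairInter_inter₃_eq,
    pairInter_inter_eq₁₂, pairInter_inter_eq₁₃, pairInter_inter_eq₂₃]
  ring

/-- **Product form.**  With the notation of `sahiE3_compl_pairInter_eq`:
`E₃((G₂∩G₃)ᶜ,(G₁∩G₃)ᶜ,(G₁∩G₂)ᶜ) = (1 + m)(1 + m₁₂ + m₁₃ + m₂₃) − (1 + m₁₂)(1 + m₁₃)(1 + m₂₃)`, so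
Sahi's inequality for this triple reads `∏ (1 + m_{ij}) ≤ (1 + m)(1 + Σ m_{ij})`.
[cite: LiebSahi2021, eq. (2.1) (arXiv p. 5)] -/
theorem sahiE3_compl_pairInter_eq_prod_form {G₁ G₂ G₃ : Set Ω} (h₁ : MeasurableSet G₁)
    (h₂ : MeasurableSet G₂) (h₃ : MeasurableSet G₃) :
    sahiE3 μ (G₂ ∩ G₃)ᶜ (G₁ ∩ G₃)ᶜ (G₁ ∩ G₂)ᶜ =
      (1 + μ.real (G₁ ∩ G₂ ∩ G₃)) *
          (1 + μ.real (G₁ ∩ G₂) + μ.real (G₁ ∩ G₃) + μ.real (G₂ ∩ G₃)) -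
        (1 + μ.real (G₁ ∩ G₂)) * (1 + μ.real (G₁ ∩ G₃)) * (1 + μ.real (G₂ ∩ G₃)) := by
  rw [sahiE3_compl_pairInter_eq μ h₁ h₂ h₃]
  ring

/-- **Sunflower form recovered.**  For a sunflower `U₁, U₂, U₃` (all pairwise intersections equal `A`) the
`G`-form gives back `E₃(U₁ᶜ,U₂ᶜ,U₃ᶜ)` in terms of `a = μ A` and the member masses `x_i = μ U_i`:
`E₃ = a(1 + x₁ + x₂ + x₃) − (x₁x₂ + x₁x₃ + x₂x₃) − x₁x₂x₃` — the tree's `sahiE3_compl_sunflower_eq` rewritten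
without petals and outside. [cite: LiebSahi2021, eq. (2.1) (arXiv p. 5)] -/
theorem sahiE3_compl_sunflower_eq_memberForm {U₁ U₂ U₃ A : Set Ω} (h₁ : MeasurableSet U₁)
    (h₂ : MeasurableSet U₂) (h₃ : MeasurableSet U₃) (h12 : U₁ ∩ U₂ = A) (h13 : U₁ ∩ U₃ = A)
    (h23 : U₂ ∩ U₃ = A) :
    sahiE3 μ U₁ᶜ U₂ᶜ U₃ᶜ =
      μ.real A * (1 + μ.real U₁ + μ.real U₂ + μ.real U₃) -
        (μ.real U₁ * μ.real U₂ + μ.real U₁ * μ.real U₃ + μ.real U₂ * μ.real U₃) -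
        μ.real U₁ * μ.real U₂ * μ.real U₃ := by
  have h123 : U₁ ∩ U₂ ∩ U₃ = A := by
    rw [h12]
    ext ω
    simp only [mem_inter_iff]
    constructor
    · intro h; exact h.1
    · intro hA
      have hA' : ω ∈ U₁ ∩ U₃ := by rw [h13]; exact hA
      exact ⟨hA, hA'.2⟩
  rw [sahiE3_compl μ h₁ h₂ h₃, sahiE3_def, h123, h12, h13, h23]
  ring

/-- **The mutually independent case.**  If `G₁, G₂, G₃` satisfy the product rule pairwise and for the
triple (e.g. increasing events depending on pairwise disjoint sets of coordinates of a product space), then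
`E₃((G₂∩G₃)ᶜ,(G₁∩G₃)ᶜ,(G₁∩G₂)ᶜ) = g₁g₂g₃(1 − g₁)(1 − g₂)(1 − g₃)` with `g_i = μ G_i`. [folklore] -/
theorem sahiE3_compl_pairInter_eq_of_indep {G₁ G₂ G₃ : Set Ω} (h₁ : MeasurableSet G₁)
    (h₂ : MeasurableSet G₂) (h₃ : MeasurableSet G₃)
    (i12 : μ.real (G₁ ∩ G₂) = μ.real G₁ * μ.real G₂) (i13 : μ.real (G₁ ∩ G₃) = μ.real G₁ * μ.real G₃)
    (i23 : μ.real (G₂ ∩ G₃) = μ.real G₂ * μ.real G₃)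
    (i123 : μ.real (G₁ ∩ G₂ ∩ G₃) = μ.real G₁ * μ.real G₂ * μ.real G₃) :
    sahiE3 μ (G₂ ∩ G₃)ᶜ (G₁ ∩ G₃)ᶜ (G₁ ∩ G₂)ᶜ =
      μ.real G₁ * μ.real G₂ * μ.real G₃ *
        ((1 - μ.real G₁) * (1 - μ.real G₂) * (1 - μ.real G₃)) := by
  rw [sahiE3_compl_pairInter_eq μ h₁ h₂ h₃, i12, i13, i23, i123]
  ring

/-- **Sahi's inequality holds for the pairwise-intersection complements of three mutually independent
events** (any probability measure): `0 ≤ E₃((G₂∩G₃)ᶜ,(G₁∩G₃)ᶜ,(G₁∩G₂)ᶜ)`, with equality iff some `μ G_i`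
is `0` or `1`.  An elementary proved case of the sunflower row outside the conditional-correlation class.
[cite: Kahn2022, Conjecture 5 (arXiv p. 3)] -/
theorem sahiE3_compl_pairInter_nonneg_of_indep {G₁ G₂ G₃ : Set Ω} (h₁ : MeasurableSet G₁)
    (h₂ : MeasurableSet G₂) (h₃ : MeasurableSet G₃)
    (i12 : μ.real (G₁ ∩ G₂) = μ.real G₁ * μ.real G₂) (i13 : μ.real (G₁ ∩ G₃) = μ.real G₁ * μ.real G₃)
    (i23 : μ.real (G₂ ∩ G₃) = μ.real G₂ * μ.real G₃)
    (i123 : μ.real (G₁ ∩ G₂ ∩ G₃) = μ.real G₁ * μ.real G₂ * μ.real G₃) :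
    0 ≤ sahiE3 μ (G₂ ∩ G₃)ᶜ (G₁ ∩ G₃)ᶜ (G₁ ∩ G₂)ᶜ := by
  rw [sahiE3_compl_pairInter_eq_of_indep μ h₁ h₂ h₃ i12 i13 i23 i123]
  have g1 : 0 ≤ μ.real G₁ := measureReal_nonneg
  have g2 : 0 ≤ μ.real G₂ := measureReal_nonneg
  have g3 : 0 ≤ μ.real G₃ := measureReal_nonneg
  have u1 : μ.real G₁ ≤ 1 := measureReal_le_one
  have u2 : μ.real G₂ ≤ 1 := measureReal_le_one
  have u3 : μ.real G₃ ≤ 1 := measureReal_le_one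
  have c1 : 0 ≤ 1 - μ.real G₁ := by linarith
  have c2 : 0 ≤ 1 - μ.real G₂ := by linarith
  have c3 : 0 ≤ 1 - μ.real G₃ := by linarith
  positivity

end Measure

/-! ### Set algebra and the polynomial identity of the abstract triangle -/

/-- `(H_j ∪ H_k) ∩ (H_i ∪ H_k) = H_k ∪ (H_i ∩ H_j)` (distributivity). [folklore] -/
theorem union_inter_union_eq (H_i H_j H_k : Set Ω) :
    (H_j ∪ H_k) ∩ (H_i ∪ H_k) = H_k ∪ (H_i ∩ H_j) := by
  ext ω; simp only [mem_inter_iff, mem_union]; tauto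

/-- `(H₂ ∪ H₃) ∩ (H₁ ∪ H₃) ∩ (H₁ ∪ H₂) = (H₁ ∩ H₂) ∪ (H₁ ∩ H₃) ∪ (H₂ ∩ H₃)` ("at least two"). [folklore] -/
theorem union_inter₃_eq_majority (H₁ H₂ H₃ : Set Ω) :
    (H₂ ∪ H₃) ∩ (H₁ ∪ H₃) ∩ (H₁ ∪ H₂) = (H₁ ∩ H₂) ∪ (H₁ ∩ H₃) ∪ (H₂ ∩ H₃) := by
  ext ω; simp only [mem_inter_iff, mem_union]; tauto

/-- **The polynomial identity of the triangle.**  With `m_{ij} = h_k + h_ih_j − h₁h₂h₃` (`{i,j,k} = {1,2,3}`)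
and `m = h₁h₂ + h₁h₃ + h₂h₃ − 2h₁h₂h₃`, the `G`-form cubic equals
`h₁h₂h₃ · (1−h₁)(1−h₂)(1−h₃) · (1 + m − (1−h₁)(1−h₂)(1−h₃))`. [folklore] -/
theorem triangle_cubic_identity (h₁ h₂ h₃ : ℝ) :
    let m₁₂ := h₃ + h₁ * h₂ - h₁ * h₂ * h₃
    let m₁₃ := h₂ + h₁ * h₃ - h₁ * h₂ * h₃
    let m₂₃ := h₁ + h₂ * h₃ - h₁ * h₂ * h₃
    let m := h₁ * h₂ + h₁ * h₃ + h₂ * h₃ - 2 * (h₁ * h₂ * h₃)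
    m * (1 + m₁₂ + m₁₃ + m₂₃) - (m₁₂ * m₁₃ + m₁₂ * m₂₃ + m₁₃ * m₂₃) - m₁₂ * m₁₃ * m₂₃ =
      h₁ * h₂ * h₃ * ((1 - h₁) * (1 - h₂) * (1 - h₃)) *
        (1 + m - (1 - h₁) * (1 - h₂) * (1 - h₃)) := by
  intro m₁₂ m₁₃ m₂₃ m
  simp only [m₁₂, m₁₃, m₂₃, m]
  ring


section Triangle

variable [MeasurableSpace Ω] (μ : Measure Ω) [IsProbabilityMeasure μ]

/-! ### The abstract triangle: `G_i = H_j ∪ H_k` with `H₁, H₂, H₃` mutually independent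

This is the percolation triangle with its three edges replaced by three arbitrary mutually independent events
`H₁, H₂, H₃` (e.g. increasing events of a product space depending on pairwise disjoint sets of coordinates):
`E_i = G_j ∩ G_k = H_i ∪ (H_j ∩ H_k)` ("`H_i`, or both others"), core `A` = "at least two of the `H`'s",
petals `P_i = H_i ∖ (H_j ∪ H_k)`, outside `B = (H₁ ∪ H₂ ∪ H₃)ᶜ`.  Sahi's cubic factorises exactly as on the
weighted triangle: `E₃ = h₁h₂h₃ · q · (1 + t − q)` with `t = μ A`, `q = μ B` — nonnegative. -/

/-- **Sahi's `C₃` for the abstract triangle.**  For every probability measure and measurable events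
`H₁, H₂, H₃` satisfying the product rule pairwise and for the triple, the three events `G_i := H_j ∪ H_k` give
`0 ≤ E₃((G₂∩G₃)ᶜ, (G₁∩G₃)ᶜ, (G₁∩G₂)ᶜ)`, i.e. Sahi's inequality holds for the three decreasing events
"neither `H_i` nor both of the other two".  (The weighted percolation triangle is the case of three independent
edges; this class is not covered by the conditional-correlation criterion.)
[cite: Kahn2022, Conjecture 5 (arXiv p. 3); LiebSahi2021, eq. (2.1) (arXiv p. 5)] -/
theorem sahiE3_compl_pairInter_nonneg_triangle {H₁ H₂ H₃ : Set Ω} (k₁ : MeasurableSet H₁)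
    (k₂ : MeasurableSet H₂) (k₃ : MeasurableSet H₃)
    (i12 : μ.real (H₁ ∩ H₂) = μ.real H₁ * μ.real H₂) (i13 : μ.real (H₁ ∩ H₃) = μ.real H₁ * μ.real H₃)
    (i23 : μ.real (H₂ ∩ H₃) = μ.real H₂ * μ.real H₃)
    (i123 : μ.real (H₁ ∩ H₂ ∩ H₃) = μ.real H₁ * μ.real H₂ * μ.real H₃) :
    0 ≤ sahiE3 μ ((H₁ ∪ H₃) ∩ (H₁ ∪ H₂))ᶜ ((H₂ ∪ H₃) ∩ (H₁ ∪ H₂))ᶜ ((H₂ ∪ H₃) ∩ (H₁ ∪ H₃))ᶜ := by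
  -- the three sets `G₁ = H₂ ∪ H₃`, `G₂ = H₁ ∪ H₃`, `G₃ = H₁ ∪ H₂`
  have hG₁ : MeasurableSet (H₂ ∪ H₃) := k₂.union k₃
  have hG₂ : MeasurableSet (H₁ ∪ H₃) := k₁.union k₃
  have hG₃ : MeasurableSet (H₁ ∪ H₂) := k₁.union k₂
  rw [sahiE3_compl_pairInter_eq μ hG₁ hG₂ hG₃]
  -- pairwise intersections of the `G`'s
  have e12 : (H₂ ∪ H₃) ∩ (H₁ ∪ H₃) = H₃ ∪ (H₁ ∩ H₂) := union_inter_union_eq H₁ H₂ H₃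
  have e13 : (H₂ ∪ H₃) ∩ (H₁ ∪ H₂) = H₂ ∪ (H₁ ∩ H₃) := by
    ext ω; simp only [mem_inter_iff, mem_union]; tauto
  have e23 : (H₁ ∪ H₃) ∩ (H₁ ∪ H₂) = H₁ ∪ (H₂ ∩ H₃) := by
    ext ω; simp only [mem_inter_iff, mem_union]; tauto
  have e123 : (H₂ ∪ H₃) ∩ (H₁ ∪ H₃) ∩ (H₁ ∪ H₂) = (H₁ ∩ H₂) ∪ (H₁ ∩ H₃) ∪ (H₂ ∩ H₃) :=
    union_inter₃_eq_majority H₁ H₂ H₃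
  -- their masses
  have t123a : H₁ ∩ H₂ ∩ H₃ = H₃ ∩ (H₁ ∩ H₂) := by
    ext ω; simp only [mem_inter_iff]; tauto
  have t123b : H₁ ∩ H₂ ∩ H₃ = H₂ ∩ (H₁ ∩ H₃) := by
    ext ω; simp only [mem_inter_iff]; tauto
  have t123c : H₁ ∩ H₂ ∩ H₃ = H₁ ∩ (H₂ ∩ H₃) := by
    ext ω; simp only [mem_inter_iff]; tauto
  have n12 : μ.real (H₃ ∪ (H₁ ∩ H₂)) = μ.real H₃ + μ.real H₁ * μ.real H₂ - μ.real H₁ * μ.real H₂ * μ.real H₃ := by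
    have h := measureReal_union_add_inter (μ := μ) (s := H₃) (k₁.inter k₂)
    rw [← t123a, i123, i12] at h
    linarith
  have n13 : μ.real (H₂ ∪ (H₁ ∩ H₃)) = μ.real H₂ + μ.real H₁ * μ.real H₃ - μ.real H₁ * μ.real H₂ * μ.real H₃ := by
    have h := measureReal_union_add_inter (μ := μ) (s := H₂) (k₁.inter k₃)
    rw [← t123b, i123, i13] at h
    linarith
  have n23 : μ.real (H₁ ∪ (H₂ ∩ H₃)) = μ.real H₁ + μ.real H₂ * μ.real H₃ - μ.real H₁ * μ.real H₂ * μ.real H₃ := by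
    have h := measureReal_union_add_inter (μ := μ) (s := H₁) (k₂.inter k₃)
    rw [← t123c, i123, i23] at h
    linarith
  -- the majority event is the union of a sunflower `H₁H₂, H₁H₃, H₂H₃` with core `H₁H₂H₃`
  have c1 : H₁ ∩ H₂ ∩ (H₁ ∩ H₃) = H₁ ∩ H₂ ∩ H₃ := by
    ext ω; simp only [mem_inter_iff]; tauto
  have c2 : H₁ ∩ H₂ ∩ (H₂ ∩ H₃) = H₁ ∩ H₂ ∩ H₃ := by
    ext ω; simp only [mem_inter_iff]; tauto
  have c3 : H₁ ∩ H₃ ∩ (H₂ ∩ H₃) = H₁ ∩ H₂ ∩ H₃ := by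
    ext ω; simp only [mem_inter_iff]; tauto
  have nmaj : μ.real ((H₁ ∩ H₂) ∪ (H₁ ∩ H₃) ∪ (H₂ ∩ H₃)) =
      μ.real H₁ * μ.real H₂ + μ.real H₁ * μ.real H₃ + μ.real H₂ * μ.real H₃ -
        2 * (μ.real H₁ * μ.real H₂ * μ.real H₃) := by
    rw [measureReal_union₃_of_pairwise_inter_eq μ (k₁.inter k₃) (k₂.inter k₃) c1 c2 c3, i12, i13, i23,
      i123]
  rw [e123, e12, e13, e23, n12, n13, n23, nmaj]
  have key := triangle_cubic_identity (μ.real H₁) (μ.real H₂) (μ.real H₃)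
  simp only at key
  rw [key]
  have g1 : 0 ≤ μ.real H₁ := measureReal_nonneg
  have g2 : 0 ≤ μ.real H₂ := measureReal_nonneg
  have g3 : 0 ≤ μ.real H₃ := measureReal_nonneg
  have u1 : μ.real H₁ ≤ 1 := measureReal_le_one
  have u2 : μ.real H₂ ≤ 1 := measureReal_le_one
  have u3 : μ.real H₃ ≤ 1 := measureReal_le_one
  have c1' : 0 ≤ 1 - μ.real H₁ := by linarith
  have c2' : 0 ≤ 1 - μ.real H₂ := by linarith
  have c3' : 0 ≤ 1 - μ.real H₃ := by linarith
  have hq : (1 - μ.real H₁) * (1 - μ.real H₂) * (1 - μ.real H₃) ≤ 1 := by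
    have h12 : (1 - μ.real H₁) * (1 - μ.real H₂) ≤ 1 := by nlinarith
    nlinarith
  have ht : 0 ≤ μ.real H₁ * μ.real H₂ + μ.real H₁ * μ.real H₃ + μ.real H₂ * μ.real H₃ -
      2 * (μ.real H₁ * μ.real H₂ * μ.real H₃) := by
    nlinarith [mul_nonneg g1 g2, mul_nonneg g1 g3, mul_nonneg g2 g3,
      mul_nonneg (mul_nonneg g1 g2) c3', mul_nonneg (mul_nonneg g1 g3) c2']
  have hlast : 0 ≤ 1 + (μ.real H₁ * μ.real H₂ + μ.real H₁ * μ.real H₃ + μ.real H₂ * μ.real H₃ -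
      2 * (μ.real H₁ * μ.real H₂ * μ.real H₃)) - (1 - μ.real H₁) * (1 - μ.real H₂) * (1 - μ.real H₃) := by
    linarith
  have hprod : 0 ≤ μ.real H₁ * μ.real H₂ * μ.real H₃ * ((1 - μ.real H₁) * (1 - μ.real H₂) * (1 - μ.real H₃)) :=
    by positivity
  exact mul_nonneg hprod hlast

end Triangle

end SahiPairInter

end Summit.CriticalPhenomena.PercolationContinuityZ3.Theorems
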